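import Mathlib.Data.Rat.Defs
import Mathlib.Tactic.Linarith
import Mathlib.Tactic.NormNum
import Mathlib.Tactic.Ring
import Mathlib.Tactic.LinearCombination
import Mathlib.Tactic.Positivity
import HarnessLib

/-!
# The (0,1) cell of the ι-window, XXI-B: the product ground `B₁ × B₂`, VIII (second file) — the orbit pairing identities, Mukai's
# relation `Ψ = Φ∘T⁻¹∘Φ⁻¹` on classes, LEMMA D₁ (the rank-two UNIT class), the hull slope bound, the rank-two tower

Family `hodge`, b2b cell `hweil` (helper of item stmt-HodgeConjecture-2524). Companion (second file, the first is at the 400-line lint) of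
`WeilTypeLadderH2ProductGroundEight.lean` (`pg8_*`, prover 1 gen 33, p246716). Report
`run/shared/lean/b2b/hodge-weil/b2b-hweil-pv1-g33/H2-ZERO-ONE-21.md` ([XXI]). HONEST FRAMING: census results inside the ladder's H2 test ((0,1)
cell) on the SPECIAL fourfold `X₀ = B₁ × B₂`; emptiness / non-isolation of a family there is a census line and nothing more. No case of the Hodge
conjecture is proved; nothing here is a rung; no statement of [Markman 2025] / [Perry 2026] / [EdGFS 2025] is used. Every head below is the
elementary arithmetic SHADOW of a named step of the report; the geometry (Mukai's Fourier functor [Mu81], Yoshioka's Lemma 4.1 [Yos01],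
Bogomolov's inequality, the cell's LEMMA U / JD / R2) is quoted print and certified items.

Conventions as in the companion: classes `(r, c, s)` on a ppas with `NS = ℤθ`, Mukai pairing `⟨(r,c,s),(r',c',s')⟩ = 2cc' − rs' − r's`,
`χ = −⟨·,·⟩`, norm `c² − rs`, slope `2c/r`; `T(r,c,s) = (r, c+r, s+2c+r)`, `Φ(r,c,s) = (s, −c, r)`, `Ψ = T∘Φ∘T`; a frame is a pair of
linear forms `λ_i = b_i X + d_i Y` with `det = b₀d₁ − b₁d₀ = ±1`, `u_i = [λ_i²] = (b_i², b_i d_i, d_i²)`, `n = [2λ₀λ₁]`,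
`[2λλ'] = (2ββ', βδ' + β'δ, 2δδ')`.

* `pg8b_psi_eq` — `Ψ(r,c,s) = (r+2c+s, c+s, s)` stated as an EQUALITY (answers referee-g118's LIGHT N-P1g33-K2 on `pg8_psi_class`), and the
  class-level form of Mukai's relation `T∘Φ∘T ≅ Φ∘T⁻¹∘Φ⁻¹∘ι^*` ([XXI] LEMMA M): `Φ(T⁻¹(Φ(r,c,s))) = Ψ(r,c,s)` (`Φ⁻¹ = ι^*Φ[2]` acts on classes as `Φ`).
* `pg8b_orbit_pairing` — the GENERAL orbit identities behind `pg8_orbit` (answers LIGHT N-P1g33-K1): for `λ = pλ₀ + qλ₁`, `λ' = p'λ₀ + q'λ₁`: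
  `χ(u₀, [2λλ']) = 2qq'·det²`, `χ(u₁, [2λλ']) = 2pp'·det²`, `χ([(λ₀−λ₁)²], [2λλ']) = 2(p+q)(p'+q')·det²` (exact polynomial identities).
* `pg8b_orbit_members` — the coefficient matrices `A^j` of the automorph `(λ₀,λ₁) ↦ (2λ₀+3λ₁, λ₀+2λ₁)` for `j = 1, 2, 3`
  (`[[2,3],[1,2]]`, `[[7,12],[4,7]]`, `[[26,45],[15,26]]`) and the resulting Euler characteristics of the orbit members in the bottom's frame:
  type I `χ(u₀, w₂^{(j)}) = 2q_j(q_j + 2q'_j) = 42, 624, 8730`; type II `3χ(u₁, w₂^{(j)}) = 6 p(λ₁^{(j)}) p(2λ₀^{(j)}+3λ₁^{(j)}) = 42, 624`; the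
  bad-factor values `χ(Ŝ, ·)`: type I `6, 110`, type II `10, 114` (hence `χ(W^∨, w₂^{(j)}) = 4, 108`).
* `pg8b_lemmaD_rank2_unit` — LEMMA D₁ ([XXI] §4.4): the arithmetic excluding a μ-destabiliser of `A_b = Φ(𝒰_b)`, `𝒰_b` μ-stable IT₀ of the
  UNIT class `(2, 2k+1, 2k²+2k)`, `k = b − 1 ≥ 1` (compare `pg8_lemmaD_rank2`, the norm-3 class `(2, 2k+1, 2k²+2k−1)`).
* `pg8b_Ab_class` — the classes of the rank-two tower: `T^{k}(2,1,0) = (2, 2k+1, 2k²+2k)`, `Φ` of it, norm `1`, `gcd = 1` witness,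
  `Ψ(2b(b−1), 2b−1, 2) = (2(b+1)b, 2b+1, 2)`, `Ψ(b²−1, b, 1) = ((b+1)²−1, b+1, 1)`, and `μ(A_b^∨) = (2b−1)/(b(b−1)) > 4/(2b−1) = μ(u₁)`
  (why the stability of `A_b^∨` is needed in the hull bound).
* `pg8b_mumax_fullA` — the two remaining integer cases of `μ_max(W_b^∨) ≤ 4/(2b−1)` ([XXI] §4.5): a subsheaf meeting `N^∨ ⊕ N^∨` in rank `be ≥ 1`
  with `b·c' ≤ be` (slope `≤ 2/b`), on top of the full `A^∨`-part resp. a proper `A^∨`-part with `(2b−1)ca ≤ 2al` (`pg8_muminW`).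
* `pg8b_rank2_tower` — the rank-two base of the second dual family ([XXI] §4.2–4.3): `E₀ = coker(𝒪 → ⊕³𝒪(Θ_i))` has class
  `3(1,1,1) − (1,0,0) = (2,3,3) = T(2,1,−1)`, hull `U' = (2,3,4) = 2(1,1,1) + (0,1,2)` (two theta line bundles and `i_*ξ₃`, `χ(ξ₃) = 3+1−2`),
  `Ψ(2,3,3) = (11,6,3)`, `Ψ(2,3,4) = (12,7,4) = W₂^∨`, `Ψ(0,1,2) = (4,3,2) = A₂^∨`, `Ψ(1,0,0) = (1,0,0)`, `Ψ(1,1,1) = (4,2,1)`; degrees on the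
  genus-2 theta divisor: `deg ξ₅ = 3 + 2 > 2 = 2g − 2` (IT₀), `3 − 2·2 < 0` (`Hom(𝒪(2Θ)P, i_*ξ₃) = 0`), `h⁰(ξ₅) = 5 + 1 − 2 = 4 = rk U₄`.
-/

-- mandated namespace `Summit.HodgeConjecture.HodgeConjecture.…` (Problem = Summit) trips `linter.dupNamespace`; the lakefile disables it
-- tree-wide (weak option), restated here so stand-alone elaboration is warning-free too.
set_option linter.dupNamespace false

namespace Summit.HodgeConjecture.HodgeConjecture.WeilTypeLadder

section ProductGroundEightB

/-- **Ψ on classes, as an equality, and Mukai's relation (report §2.1, LEMMA M; N-P1g33-K2).** `T(Φ(T(r,c,s))) = (r+2c+s, c+s, s)` and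
`Φ(T⁻¹(Φ(r,c,s))) = (r+2c+s, c+s, s)`: the autoequivalence `Ψ = T∘Φ∘T` and the conjugate `Φ∘T⁻¹∘Φ⁻¹` act identically on classes (on objects
they agree up to `ι^*`, [Mu81] (3.1), (3.8), 3.11 and the theorem of the cube: the kernel of `Φ∘T∘Φ` is `m^*𝒪(−Θ) = p₁^*𝒪(−Θ) ⊗ (1×ι)^*𝒫 ⊗
p₂^*𝒪(−Θ)`). [shadow: `ring`] -/
theorem pg8b_psi_eq (r c s : ℤ) :
    (let T := fun (u : ℤ × ℤ × ℤ) => (u.1, u.2.1 + u.1, u.2.2 + 2 * u.2.1 + u.1)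
     let Φ := fun (u : ℤ × ℤ × ℤ) => (u.2.2, -u.2.1, u.1)
     T (Φ (T (r, c, s))) = (r + 2 * c + s, c + s, s)) ∧
    (let Tinv := fun (u : ℤ × ℤ × ℤ) => (u.1, u.2.1 - u.1, u.2.2 - 2 * u.2.1 + u.1)
     let Φ := fun (u : ℤ × ℤ × ℤ) => (u.2.2, -u.2.1, u.1)
     Φ (Tinv (Φ (r, c, s))) = (r + 2 * c + s, c + s, s)) := by
  simp only
  refine ⟨?_, ?_⟩ <;> ext <;> simp <;> ring

/-- **The orbit pairing identities (report §1.4; N-P1g33-K1).** In a frame `λ₀ = (b₀,d₀)`, `λ₁ = (b₁,d₁)` (any integers; `det := b₀d₁ −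
b₁d₀`), for `λ = pλ₀ + qλ₁` and `λ' = p'λ₀ + q'λ₁` the class `[2λλ']` pairs as follows (χ = −⟨·,·⟩): `χ(u₀, [2λλ']) = 2qq'·det²`,
`χ(u₁, [2λλ']) = 2pp'·det²`, `χ(Ŝ, [2λλ']) = 2(p+q)(p'+q')·det²` with `Ŝ = [(λ₀−λ₁)²]`. Hence along the orbit `(λ₀,λ₁) ↦ A^j(λ₀,λ₁)` every
Euler characteristic of the report is `2·(product of two orbit coefficients)`: positive and increasing for `j ≥ 1`. [shadow: `ring`] -/
theorem pg8b_orbit_pairing (b0 d0 b1 d1 p q p' q' : ℤ) :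
    let pr := fun (u w : ℤ × ℤ × ℤ) => 2 * u.2.1 * w.2.1 - u.1 * w.2.2 - w.1 * u.2.2
    let det := b0 * d1 - b1 * d0
    let u0 : ℤ × ℤ × ℤ := (b0 ^ 2, b0 * d0, d0 ^ 2)
    let u1 : ℤ × ℤ × ℤ := (b1 ^ 2, b1 * d1, d1 ^ 2)
    let Sh : ℤ × ℤ × ℤ := ((b0 - b1) ^ 2, (b0 - b1) * (d0 - d1), (d0 - d1) ^ 2)
    -- λ = (β, δ), λ' = (β', δ')
    let β := p * b0 + q * b1
    let δ := p * d0 + q * d1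
    let β' := p' * b0 + q' * b1
    let δ' := p' * d0 + q' * d1
    let m : ℤ × ℤ × ℤ := (2 * β * β', β * δ' + β' * δ, 2 * δ * δ')
    (-pr u0 m = 2 * q * q' * det ^ 2) ∧ (-pr u1 m = 2 * p * p' * det ^ 2) ∧ (-pr Sh m = 2 * (p + q) * (p' + q') * det ^ 2) := by
  simp only
  refine ⟨by ring, by ring, by ring⟩

/-- **The orbit members `j = 1, 2, 3` (report §1.4; N-P1g33-K1: the numerals `624`, `8730` of `pg8_orbit` DERIVED).** The automorph
`A : (λ₀,λ₁) ↦ (2λ₀+3λ₁, λ₀+2λ₁)` has coefficient matrices `A¹ = [[2,3],[1,2]]`, `A² = [[7,12],[4,7]]`, `A³ = [[26,45],[15,26]]` (rows = the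
coefficients `(p_j,q_j)` of `λ₀^{(j)}` and `(p'_j,q'_j)` of `λ₁^{(j)}`). TYPE I (`w₂^{(j)} = 2[λ₀^{(j)}(λ₀^{(j)}+2λ₁^{(j)})]`, adjacent piece `u₀`):
`χ(u₀, w₂^{(j)}) = 2q_j(q_j + 2q'_j)` = `0, 42, 624, 8730` for `j = 0,1,2,3`; bad factor (`Ŝ ↠`): `χ(Ŝ, w₂^{(j)}) = 2(p_j+q_j)(p_j+q_j+2(p'_j+q'_j))`
= `6, 110, 1558`. TYPE II (`w₂^{(j)} = 2[λ₁^{(j)}(2λ₀^{(j)}+3λ₁^{(j)})]`, adjacent piece three copies of `u₁`): `3χ(u₁, w₂^{(j)}) =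
6 p'_j (2p_j + 3p'_j)` = `0, 42, 624`; bad hull: `χ(Ŝ, w₂^{(j)}) = 2(p'_j+q'_j)(2(p_j+q_j)+3(p'_j+q'_j))` = `10, 114`, so
`χ(W^∨, w₂^{(j)}) = χ(Ŝ, ·) − 6 = 4, 108`. [shadow: `norm_num`] -/
theorem pg8b_orbit_members :
    -- A², A³ as products
    ((2 * 2 + 3 * 1, 2 * 3 + 3 * 2, 1 * 2 + 2 * 1, 1 * 3 + 2 * 2) = ((7 : ℤ), (12 : ℤ), (4 : ℤ), (7 : ℤ))) ∧
    ((2 * 7 + 3 * 4, 2 * 12 + 3 * 7, 1 * 7 + 2 * 4, 1 * 12 + 2 * 7) = ((26 : ℤ), (45 : ℤ), (15 : ℤ), (26 : ℤ))) ∧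
    -- type I adjacent: 2 q_j (q_j + 2 q'_j)
    (2 * 0 * (0 + 2 * 1) = (0 : ℤ) ∧ 2 * 3 * (3 + 2 * 2) = (42 : ℤ) ∧ 2 * 12 * (12 + 2 * 7) = (624 : ℤ) ∧
      2 * 45 * (45 + 2 * 26) = (8730 : ℤ)) ∧
    -- type I bad: 2 (p_j+q_j) ((p_j+q_j) + 2 (p'_j+q'_j))
    (2 * (1 + 0) * ((1 + 0) + 2 * (0 + 1)) = (6 : ℤ) ∧ 2 * (2 + 3) * ((2 + 3) + 2 * (1 + 2)) = (110 : ℤ) ∧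
      2 * (7 + 12) * ((7 + 12) + 2 * (4 + 7)) = (1558 : ℤ)) ∧
    -- type II adjacent: 3 · 2 p'_j (2 p_j + 3 p'_j)
    (3 * (2 * 0 * (2 * 1 + 3 * 0)) = (0 : ℤ) ∧ 3 * (2 * 1 * (2 * 2 + 3 * 1)) = (42 : ℤ) ∧ 3 * (2 * 4 * (2 * 7 + 3 * 4)) = (624 : ℤ)) ∧
    -- type II bad hull: 2 (p'_j+q'_j) (2(p_j+q_j) + 3(p'_j+q'_j)), minus χ(v, w₂) = -6... i.e. χ(W^∨,w₂^{(j)}) = value - 6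
    (2 * (0 + 1) * (2 * (1 + 0) + 3 * (0 + 1)) = (10 : ℤ) ∧ 2 * (1 + 2) * (2 * (2 + 3) + 3 * (1 + 2)) = (114 : ℤ) ∧
      (10 : ℤ) - 6 = 4 ∧ (114 : ℤ) - 6 = 108) := by
  refine ⟨by norm_num, by norm_num, ⟨by norm_num, by norm_num, by norm_num, by norm_num⟩, ⟨by norm_num, by norm_num, by norm_num⟩,
    ⟨by norm_num, by norm_num, by norm_num⟩, ⟨by norm_num, by norm_num, by norm_num, by norm_num⟩⟩

/-- **LEMMA D₁ — no μ-destabiliser of `A_b = Φ(𝒰_b)` (report §4.4).** `𝒰 := 𝒰_b` is a μ-stable IT₀ vector bundle of the UNIT class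
`(2, 2k+1, 2k²+2k)`, `k = b − 1 ≥ 1`, and `F = Φ(𝒰)` has class `(2k²+2k, −(2k+1), 2)`. If `F` were not μ-semistable, its first
Harder–Narasimhan factor `F₁`, of class `(a, −d, l)`, would satisfy: `1 ≤ a ≤ 2k²+2k−1`; `d ≥ 1` (Yoshioka's Lemma 4.1: `μ_max(Φ(𝒰)) < 0`);
`l ≥ 1` (LEMMA D (iii)); `a·l ≤ d²` (Bogomolov, `⟨v(F₁)²⟩ ≥ 0`); `d(2k²+2k) ≤ a(2k+1)` (slope); and if `l = 1` then `Φ̂²(F₁)` is a rank-one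
subsheaf of the μ-stable rank-two `𝒰`, so `2d < 2k+1`, `d ≤ k`. These are contradictory; as `gcd(2k²+2k, 2k+1) = 1`, μ-semistable = μ-stable.
[shadow: the whole arithmetic] -/
theorem pg8b_lemmaD_rank2_unit (k a d l : ℤ) (hk : 1 ≤ k) (ha : 1 ≤ a) (ha' : a ≤ 2 * k ^ 2 + 2 * k - 1) (hd : 1 ≤ d) (hl : 1 ≤ l)
    (hbog : a * l ≤ d ^ 2) (hslope : d * (2 * k ^ 2 + 2 * k) ≤ a * (2 * k + 1)) (hJ : l = 1 → d ≤ k) : False := by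
  rcases eq_or_lt_of_le hl with hl1 | hl2
  · -- l = 1
    have hl' : l = 1 := hl1.symm
    have hdk : d ≤ k := hJ hl'
    subst hl'
    have h1 : a ≤ d ^ 2 := by linarith
    have h2 : a * (2 * k + 1) ≤ d ^ 2 * (2 * k + 1) := by nlinarith
    have h3a : d * d ≤ d * k := mul_le_mul_of_nonneg_left hdk (by linarith)
    have h3 : d ^ 2 * (2 * k + 1) ≤ d * k * (2 * k + 1) := by
      have : d ^ 2 = d * d := by ring
      rw [this]; exact mul_le_mul_of_nonneg_right h3a (by linarith)
    have h4 : d * (2 * k ^ 2 + 2 * k) ≤ d * (k * (2 * k + 1)) := by nlinarith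
    have h5 : 2 * k ^ 2 + 2 * k ≤ k * (2 * k + 1) := le_of_mul_le_mul_left h4 (by linarith)
    nlinarith
  · -- l ≥ 2
    have h1 : 2 * a ≤ d ^ 2 := by nlinarith
    have h2 : 2 * (d * (2 * k ^ 2 + 2 * k)) ≤ d ^ 2 * (2 * k + 1) := by nlinarith
    have h3 : 2 * (2 * k ^ 2 + 2 * k) ≤ d * (2 * k + 1) := by nlinarith
    have h4 : 2 * k + 1 ≤ d := by nlinarith
    have h5 : (2 * k + 1) * (2 * k ^ 2 + 2 * k) ≤ a * (2 * k + 1) := by nlinarith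
    have h6 : 2 * k ^ 2 + 2 * k ≤ a := by nlinarith
    linarith

/-- **The classes of the rank-two tower (report §4.3–4.4).** `T^k(2,1,0) = (2, 2k+1, 2k²+2k)` (one step: `T(2, 2k+1, 2k²+2k) =
(2, 2(k+1)+1, 2(k+1)²+2(k+1))`); `Φ(2, 2b−1, 2b²−2b) = (2b²−2b, −(2b−1), 2) = A_b`, norm `1`, and `(2b−1)·(2b−1) − 2·(2b²−2b) = 1`
(so rank and degree are coprime: μ-semistable = μ-stable); the Ψ-steps `Ψ(2b(b−1), 2b−1, 2) = (2(b+1)b, 2(b+1)−1, 2)` (`A_b^∨ ↦ A_{b+1}^∨`),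
`Ψ((b−1)², b−1, 1) = (b², b, 1)` (`Ŝ_{b−1} ↦ Ŝ_b`), `Ψ(b²−1, b, 1) = ((b+1)²−1, b+1, 1)`, `Ψ(4b²−2b, 4b−1, 4) = (4(b+1)²−2(b+1), 4(b+1)−1, 4)`
(`W_b^∨ ↦ W_{b+1}^∨`); and the slope comparison `μ(A_b^∨) = (2b−1)/(b(b−1)) > 4/(2b−1) = μ(u₁)` for `b ≥ 2` (cleared: `4b(b−1) < (2b−1)²`).
[shadow: `ring` / `nlinarith`] -/
theorem pg8b_Ab_class (k b : ℤ) :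
    ((2 : ℤ) = 2 ∧ (2 * k + 1) + 2 = 2 * (k + 1) + 1 ∧ (2 * k ^ 2 + 2 * k) + 2 * (2 * k + 1) + 2 = 2 * (k + 1) ^ 2 + 2 * (k + 1)) ∧
    ((2 * b - 1) ^ 2 - (2 * b ^ 2 - 2 * b) * 2 = 1 ∧ (2 * b - 1) * (2 * b - 1) - 2 * (2 * b ^ 2 - 2 * b) = 1) ∧
    ((2 * b * (b - 1) + 2 * (2 * b - 1) + 2 = 2 * (b + 1) * b) ∧ ((2 * b - 1) + 2 = 2 * (b + 1) - 1)) ∧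
    (((b - 1) ^ 2 + 2 * (b - 1) + 1 = b ^ 2) ∧ ((b - 1) + 1 = b)) ∧
    (((b ^ 2 - 1) + 2 * b + 1 = (b + 1) ^ 2 - 1) ∧ (b + 1 = b + 1)) ∧
    (((4 * b ^ 2 - 2 * b) + 2 * (4 * b - 1) + 4 = 4 * (b + 1) ^ 2 - 2 * (b + 1)) ∧ ((4 * b - 1) + 4 = 4 * (b + 1) - 1)) ∧
    (2 ≤ b → 4 * b * (b - 1) < (2 * b - 1) ^ 2) := by
  refine ⟨⟨rfl, by ring, by ring⟩, ⟨by ring, by ring⟩, ⟨by ring, by ring⟩, ⟨by ring, by ring⟩, ⟨by ring, rfl⟩, ⟨by ring, by ring⟩,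
    fun _ => by nlinarith⟩

/-- **The hull slope bound, remaining integer cases (report §4.5).** `W_b^∨ = Ψ^{b−1}(U')` is an extension `0 → N'^∨ ⊕ N''^∨ → W_b^∨ →
A_b^∨ → 0` (`N^∨` simple semi-homogeneous of class `(b², b, 1)`, slope `2/b`; `A_b^∨` μ-stable of class `(2b(b−1), 2b−1, 2)`) admitting no
non-zero map from `A_b^∨`. For a saturated `F ⊂ W_b^∨` let `F' = F ∩ (N^∨ ⊕ N^∨)` (rank `be`, `c₁ = c'θ̂`, slope `≤ 2/b`: `b·c' ≤ be`) and
`F'' = F/F' ⊂ A_b^∨` (rank `al`, `c₁ = ca·θ̂`). (i) `F'' = A_b^∨` forces `be ≥ 1`, and then `μ(F) ≤ 4/(2b−1)`: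
`(2b−1)(c' + 2b−1) ≤ 2(be + 2b²−2b)`. (ii) `F''` proper: `(2b−1)·ca ≤ 2·al` (`pg8_muminW`, dual form) and `b c' ≤ be` give
`(2b−1)(ca + c') ≤ 2(al + be)`. With `pg8_muminW_cases` (`F'' = 0`: `2/b < 4/(2b−1)`): `μ_max(W_b^∨) ≤ 4/(2b−1) = μ(u₁) < μ(w₂), μ(w₁)`.
[shadow: `nlinarith` after a sign split on `c'`] -/
theorem pg8b_mumax_fullA (b be c' al ca : ℤ) (hb : 2 ≤ b) (hbe : 1 ≤ be) (hc : b * c' ≤ be) :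
    ((2 * b - 1) * (c' + 2 * b - 1) ≤ 2 * (be + 2 * b ^ 2 - 2 * b)) ∧
    ((2 * b - 1) * ca ≤ 2 * al → (2 * b - 1) * (ca + c') ≤ 2 * (al + be)) := by
  constructor
  · by_cases h : c' ≤ 0
    · nlinarith
    · push Not at h
      nlinarith
  · intro hA
    by_cases h : c' ≤ 0
    · nlinarith
    · push Not at h
      nlinarith

/-- **The rank-two base of the second dual family (report §4.2–4.3).** Classes: the theta line bundles `𝒪(Θ_i)` have class `(1,1,1)`, so
`E₀ = coker(𝒪 → ⊕_{i=1}^3 𝒪(Θ_i))` has class `(2,3,3) = T(2,1,−1) = T²(2,−1,−1)` (the rank-two rigid class, norm `3`); its reflexive hull `U'`,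
an extension of `i_*ξ₃` (class `(0,1,χ(ξ₃))`, `χ(ξ₃) = 3 + 1 − 2 = 2`) by `𝒪(Θ₁) ⊕ 𝒪(Θ₂)`, has class `(2,3,4)` (norm `1`), and `U'/E₀ = k(w)` has
class `(0,0,1)`. One Ψ-step: `Ψ(2,3,3) = (11,6,3)` (the rank-11 dual class, `b = 2`), `Ψ(2,3,4) = (12,7,4) = W₂^∨`, `Ψ(0,1,2) = (4,3,2) =
A₂^∨`, `Ψ(1,1,1) = (4,2,1) = N₂^∨`, `Ψ(0,0,1) = (1,1,1) = Ŝ₁`, `Ψ(0,1,1) = (3,2,1) = D₂`, `Ψ(1,0,0) = (1,0,0)`. Degrees on the genus-two theta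
divisor: `deg ξ₅ = 3 + 2 = 5 > 2 = 2g−2` (`i_*ξ₅` is IT₀, `h⁰ = 5 + 1 − 2 = 4 = rk U₄`), `3 − 2·2 < 0` (`Hom(𝒪(2Θ)P, i_*ξ₃) = 0`: `U'` is
μ-stable), `deg K_C ⊗ 𝒪(Θ)|_C = 2 + 2 > 2`. Counts: `8192` locally free + `10240` non-locally-free rigid rank-two sheaves `= 18432 = 2·16·576`.
[shadow: `norm_num`] -/
theorem pg8b_rank2_tower :
    ((3 * 1 - 1, 3 * 1 - 0, 3 * 1 - 0) = ((2 : ℤ), (3 : ℤ), (3 : ℤ))) ∧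
    ((2, 1 + 2, -1 + 2 * 1 + 2) = ((2 : ℤ), (3 : ℤ), (3 : ℤ))) ∧ ((2, -1 + 2, -1 + 2 * (-1) + 2) = ((2 : ℤ), (1 : ℤ), (-1 : ℤ))) ∧
    ((3 : ℤ) ^ 2 - 2 * 3 = 3) ∧
    ((2 * 1 + 0, 2 * 1 + 1, 2 * 1 + (3 + 1 - 2)) = ((2 : ℤ), (3 : ℤ), (4 : ℤ))) ∧ ((3 : ℤ) ^ 2 - 2 * 4 = 1) ∧
    ((2 + 2 * 3 + 3, 3 + 3, 3) = ((11 : ℤ), (6 : ℤ), (3 : ℤ))) ∧ ((2 + 2 * 3 + 4, 3 + 4, 4) = ((12 : ℤ), (7 : ℤ), (4 : ℤ))) ∧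
    ((0 + 2 * 1 + 2, 1 + 2, 2) = ((4 : ℤ), (3 : ℤ), (2 : ℤ))) ∧ ((1 + 2 * 1 + 1, 1 + 1, 1) = ((4 : ℤ), (2 : ℤ), (1 : ℤ))) ∧
    ((0 + 2 * 0 + 1, 0 + 1, 1) = ((1 : ℤ), (1 : ℤ), (1 : ℤ))) ∧ ((0 + 2 * 1 + 1, 1 + 1, 1) = ((3 : ℤ), (2 : ℤ), (1 : ℤ))) ∧
    ((1 + 2 * 0 + 0, 0 + 0, 0) = ((1 : ℤ), (0 : ℤ), (0 : ℤ))) ∧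
    ((3 + 2 = (5 : ℤ)) ∧ ((2 : ℤ) < 5) ∧ (5 + 1 - 2 = (4 : ℤ)) ∧ ((3 : ℤ) - 2 * 2 < 0) ∧ ((2 : ℤ) < 2 + 2)) ∧
    (8192 + 10240 = (18432 : ℕ) ∧ 2 * 16 * 576 = (18432 : ℕ)) := by
  refine ⟨by norm_num, by norm_num, by norm_num, by norm_num, by norm_num, by norm_num, by norm_num, by norm_num, by norm_num,
    by norm_num, by norm_num, by norm_num, by norm_num, ⟨by norm_num, by norm_num, by norm_num, by norm_num, by norm_num⟩,
    ⟨by norm_num, by norm_num⟩⟩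

end ProductGroundEightB

end Summit.HodgeConjecture.HodgeConjecture.WeilTypeLadder
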